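import Mathlib
import HarnessLib

/-!
# Kimura–Niitsuma (1980): regular local rings of characteristic `p` and `p`-bases — STATEMENTS ONLY (named facts F-96 / F-96b)

Topic: `Literature/RingTheory/PBasis`. T. Kimura and H. Niitsuma, *Regular local ring of characteristic p and p-basis*,
J. Math. Soc. Japan **32** (1980), no. 2, 363–371, doi:10.2969/jmsj/03220363 (held text
`paper:kimura1980-regular-local-ring-characteristic-p-p-basis`, pages read: p. 363 = file p0001, p. 364 = p0002, p. 367 = p0005,
p. 370 = p0008). Typed AS PRINTED (D-0014 / D-0026 named facts; users take `(h : KimuraNiitsuma1980_thm_3_4)`):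

* the printed DEFINITION (p. 363 l. 7–10): "Let `p` be always a prime number, `R` a local ring of characteristic `p` and `R′` an
  intermediate local ring between `R` and `R^p`. A `p`-basis of `R` over `R′` means a subset `Γ` of `R` such that `R′[Γ] = R` and
  such that for every finite subset `{b₁, …, b_s}` of `Γ`, `{b₁^{n₁} ⋯ b_s^{n_s} | 0 ≤ nᵢ < p}` is linearly independent over `R′`."
  — `IsPBasisOver R′ Γ` below, for ANY subring `R′ ⊆ R` (the tree's `Literature.NumberTheory.GaloisCohomology.IsPBasis` is the
  FINITE-family special case over `R′ = R^p` phrased through the Frobenius twist; the printed notion allows INFINITE `Γ`, which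
  Theorem 3.4 needs — e.g. a locality over a field `L` with `[L : L^p] = ∞`); `R^p = {a^p | a ∈ R}` (p. 364 l. −6) is the subring
  `(frobenius R p).range`;
* **F-96 = Theorem 3.4** (p. 363 and p. 370): "Let `R` be a locality over a field of characteristic `p`. Then `R` is regular if and
  only if `R` has a `p`-basis over `R^p`." with footnote 1) p. 363: "A locality over a field means a quotient ring of an affine domain
  over a field with respect to a prime ideal (cf. [5])" — rendered as `R = S_𝔭`, `S` a finitely generated commutative `L`-algebra
  which is a domain, `𝔭` a prime ideal of `S`;
* **F-96b = Theorem 3.1, first half** (p. 363): "Let `R` be a regular local ring of characteristic `p` and let `k` be the residue field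
  of `R`. If there is a system of representatives `A` of a `p`-basis of `k` over `k^p` such that `R` is a finite `R^p[A]`-module, then
  `R` has a `p`-basis over `R^p`. More precisely, a `p`-basis of `R` over `R^p` is obtained as the union of `{z₁, …, z_r}` and `A` where
  `r = dim R` and `{z₁, …, z_r}` is a special minimal system of generators for the maximal ideal of `R`." ("special" refers to the
  construction of Lemma 2.6 p. 367; we type "SOME minimal system of generators", which is what the sentence asserts);
* Theorem 3.1, second half (p. 363), regularity clause: "Conversely, if `R` is a reduced local ring of characteristic `p` and if `R`
  has a `p`-basis `Γ` over `R^p`, then `R` is a regular local ring [and `Γ` is of the form `A ∪ {z₁ + v₁, …, z_r + v_r}` …]" — the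
  bracketed shape clause is not typed (`-- TODO(general form)` below).

Infinite residue `p`-bases are in print and allowed (the `A` of Thm. 3.1 may be infinite). NOT statements of H. Hironaka's 2017
manuscript; settled refereed 1980 mathematics typed as named facts for the L-lane (consumer: W8.1, Giraud 1983 §1.4 over
non-`F`-finite fields). Typed by HIRONAKA-L librarian res-D-lib-1 (custody DEAL #38 (1), desk row res-dag-4 17:51:04Z).
Revision 2 (docstring only, declarations byte-identical; res-lit-3, c3 reader of record, 2026-08-27): the paper's reference
[2], invoked for the regularity half of Thm. 3.1, is E. Kunz 1969 (reference list p. 371 l. 29–30) — corrected below.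

## References
* T. Kimura, H. Niitsuma, *Regular local ring of characteristic p and p-basis*, J. Math. Soc. Japan 32 (1980) 363–371. [KimuraNiitsuma1980]
* E. Kunz, *Characterizations of regular local rings of characteristic p*, Amer. J. Math. 91 (1969) 772–784 (the paper's
  reference [2]; its Thm. 2.1 gives the regularity in the second half of Thm. 3.1). [Kunz1969]
* H. Matsumura, *Commutative Ring Theory*, §26 (p-bases). [Matsumura1987]
-/

namespace Literature.RingTheory.PBasis

universe u

open IsLocalRing

/-- **Kimura–Niitsuma's `p`-basis over an intermediate ring** (p. 363 l. 7–10, printed definition): for a subring `R′ ⊆ R`, a subset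
`Γ ⊆ R` is a *`p`-basis of `R` over `R′`* if `R′[Γ] = R` and, for every finite subset `{b₁, …, b_s} ⊆ Γ` (rendered: every finite
family of distinct elements of `Γ`), the monomials `b₁^{n₁} ⋯ b_s^{n_s}` with `0 ≤ nᵢ < p` are linearly independent over `R′`
(`R` as an `R′`-module through the inclusion). [cite: KimuraNiitsuma1980, p. 363 l. 7–10] -/
def IsPBasisOver (p : ℕ) {R : Type u} [CommRing R] (R' : Subring R) (Γ : Set R) : Prop :=
  Algebra.adjoin R' Γ = ⊤ ∧
    ∀ (s : ℕ) (b : Fin s → R), Function.Injective b → (∀ i, b i ∈ Γ) →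
      LinearIndependent R' (fun n : Fin s → Fin p => ∏ i, b i ^ ((n i : ℕ)))

/-- NAMED FACT (F-96) — **Kimura–Niitsuma 1980, Theorem 3.4** (p. 363; proof p. 370): "Let `R` be a locality over a field of
characteristic `p`. Then `R` is regular if and only if `R` has a `p`-basis over `R^p`." Footnote 1) p. 363: a locality over a field
is the localisation `S_𝔭` of an affine domain `S` over a field `L` at a prime ideal `𝔭`. `R^p = {a^p | a ∈ R}` (p. 364) is the range
of the Frobenius endomorphism. The field `L` is arbitrary of characteristic `p` (`[L : L^p]` may be infinite; then the `p`-basis is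
infinite). Statement only (D-0026); users take `(h : KimuraNiitsuma1980_thm_3_4)`.
[cite: KimuraNiitsuma1980, Thm. 3.4 p. 363 and p. 370] -/
def KimuraNiitsuma1980_thm_3_4 : Prop :=
  ∀ (p : ℕ) [Fact p.Prime] (L : Type u) [Field L] [CharP L p] (S : Type u) [CommRing S] [IsDomain S] [Algebra L S]
    [Algebra.FiniteType L S] (P : Ideal S) [P.IsPrime] [CharP (Localization.AtPrime P) p],
    IsRegularLocalRing (Localization.AtPrime P) ↔
      ∃ Γ : Set (Localization.AtPrime P), IsPBasisOver p (frobenius (Localization.AtPrime P) p).range Γ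

/-- NAMED FACT (F-96b) — **Kimura–Niitsuma 1980, Theorem 3.1, first half** (p. 363; via Lemma 2.6 p. 367): "Let `R` be a regular
local ring of characteristic `p` and let `k` be the residue field of `R`. If there is a system of representatives `A` of a `p`-basis
of `k` over `k^p` such that `R` is a finite `R^p[A]`-module, then `R` has a `p`-basis over `R^p`. More precisely, a `p`-basis of `R`
over `R^p` is obtained as the union of `{z₁, …, z_r}` and `A` where `r = dim R` and `{z₁, …, z_r}` is a special minimal system of
generators for the maximal ideal of `R`." Rendering: `A ⊆ R` with the residue map injective on `A` and `Ā` a `p`-basis of `k` over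
`k^p = (frobenius k p).range` (the `p`-basis `Ā` may be INFINITE); `R` module-finite over the subalgebra `R^p[A]`; conclusion: some
`z : Fin r → R`, `r = dim R`, whose range generates `𝔪` (a minimal system of generators, `r = dim R = emb dim R` for regular `R`),
with `A ∪ {z₁, …, z_r}` a `p`-basis of `R` over `R^p`. Statement only (D-0026).
[cite: KimuraNiitsuma1980, Thm. 3.1 p. 363; Lemma 2.6 p. 367] -/
def KimuraNiitsuma1980_thm_3_1 : Prop :=
  ∀ (p : ℕ) [Fact p.Prime] (R : Type u) [CommRing R] [IsRegularLocalRing R] [CharP R p] [CharP (ResidueField R) p]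
    (A : Set R), Set.InjOn (residue R) A →
      IsPBasisOver p (frobenius (ResidueField R) p).range (residue R '' A) →
        Module.Finite (Algebra.adjoin (frobenius R p).range A) R →
          ∃ (r : ℕ) (z : Fin r → R), ringKrullDim R = r ∧ Ideal.span (Set.range z) = maximalIdeal R ∧
            IsPBasisOver p (frobenius R p).range (A ∪ Set.range z)

/-- NAMED FACT — **Kimura–Niitsuma 1980, Theorem 3.1, second half, regularity clause** (p. 363): "Conversely, if `R` is a reduced
local ring of characteristic `p` and if `R` has a `p`-basis `Γ` over `R^p`, then `R` is a regular local ring" ("local ring" =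
Noetherian with one maximal ideal, p. 364 §1; the regularity "follows immediately from Theorem 2.1 of [2]" (p. 363 l. 29–30,
p. 369 l. 21–22), where [2] = E. Kunz, *Characterizations of regular local rings of characteristic p*, Amer. J. Math. 91
(1969) 772–784 — reference list p. 371). Statement only (D-0026).
[cite: KimuraNiitsuma1980, Thm. 3.1 p. 363 (second half)] -/
def KimuraNiitsuma1980_thm_3_1_converse : Prop :=
  ∀ (p : ℕ) [Fact p.Prime] (R : Type u) [CommRing R] [IsLocalRing R] [IsNoetherianRing R] [IsReduced R] [CharP R p]
    (Γ : Set R), IsPBasisOver p (frobenius R p).range Γ → IsRegularLocalRing R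
-- TODO(general form): the printed second half also asserts the SHAPE of every such `Γ`:
-- `Γ = A ∪ {z₁ + v₁, …, z_r + v_r}`, `vᵢ ∈ R^p[A]`, `A` a system of representatives of a `p`-basis of `k` over `k^p`,
-- `{z₁, …, z_r}` a minimal system of generators of `𝔪`.

end Literature.RingTheory.PBasis
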